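import Summits.NavierStokesRegularity.NavierStokesRegularity.Theorems.ExtremiserTransiencePerFlowNearEfficientRecurrence
import Summits.NavierStokesRegularity.NavierStokesRegularity.Theorems.EfficiencyFloorEnstrophyBudget
import HarnessLib

/-!
# Route `ExtremiserTransience`, LINE g4-α «per-flow-tangent» (ns-idea-5 g4): EFFICIENCY CAPS THE
# PALINSTROPHY-TO-ENSTROPHY RATIO BY THE STRAIN — the upper scale-lock at near-efficient times, modulo rates

`--supports stmt-NavierStokesRegularity-26568` (`TangentExtremalExtraction`; skeleton v2 stub `stub_scaleLock`).

Companion of `…PerFlowEfficiencyForcesPalinstrophy.lean` (floor `Z·P ≥ (mM/c_L)⁴` at efficient times). Here the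
CEILING: the vortex-stretching integral is trivially at most `‖∇v‖_∞ · ‖ω‖₂²`, so an `m`-efficient field
(`m·M·‖ω‖₂·‖∇ω‖₂ < |∫⟪ω,∇v ω⟫|`, `m > 0`) with `|∇v| ≤ B` has `m²M²·‖∇ω‖₂² ≤ B²·‖ω‖₂²`:

* `stretching_abs_le_gradBound_mul_enstrophy` — `|∫⟪curl v, Dv curl v⟫| ≤ B · ∫|curl v|²` for `v ∈ C²` with
  `Dv ∈ L²` and `‖Dv‖ ≤ B` pointwise.
* `palinstrophy_le_of_efficient` — STATIC: `m·M·√Z·√P < |J|`, `0 < m`, `|∇v| ≤ B` ⇒ `m²·M²·P ≤ B²·Z`.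
* `palinstrophy_cap_at_nearEfficient_times` — ALONG THE FLOW: if the per-flow conclusion of
  `NearExtremalTransiencePerFlow` fails (classical Leray–Hopf rapidly-decaying-datum solution on `[0,T)`), then for
  every `0 < m < κ⋆` and `t₁ < T` the late times `t ∈ [t₁,T)` carrying an amplitude bound `M` with
  `m·M·√Z·√P < |J|` AND, for every gradient bound `B` of `u(t)`, `m²M²·P(t) ≤ B²·Z(t)`, have positive measure.

WHERE THIS SITS IN THE LOCK (`ρ := ν(T−t)·P/Z`). At such a time `ρ ≤ ν(T−t)·B(t)²/(m²M²)`; with a gradient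
Type-I bound `B(t) ≤ C₁/(T−t)` (parabolic regularity of Type-I solutions) and Leray's lower blow-up rate
`‖u(t)‖_∞ ≥ c₀√(ν/(T−t))` (so every admissible `M ≥ c₀√(ν/(T−t))`) this is the UPPER LOCK `ρ ≤ C₁²/(m²c₀²)` at
every near-efficient time. Neither rate is proved or assumed in this file; the LOWER lock (enstrophy at Leray's
minimal rate at efficient times) remains the open content of `stub_scaleLock`.

HONEST FRAMING: elementary consequences of landed inequalities; no depletion, no lock, nothing about
Navier–Stokes regularity or blow-up is proved; items 26567/26568 stay open. References: Leray 1934 §19;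
Robinson–Rodrigo–Sadowski 2016, Lemma 8.16. [folklore]
-/

noncomputable section
open Set Filter Topology MeasureTheory
open scoped InnerProductSpace RealInnerProductSpace ENNReal NNReal ContDiff
open Literature.Analysis.FluidPDE

namespace Summit.NavierStokesRegularity.NavierStokesRegularity.Theorems.DepletionLadder.PerFlow
set_option linter.dupNamespace false
set_option linter.style.longLine false

open Summit.NavierStokesRegularity.NavierStokesRegularity.Theorems.EnstrophyBudget (isLocalSolution sobolev_slice)
open Summit.NavierStokesRegularity.NavierStokesRegularity.Theorems.RungReynoldsOne (enorm_curl_sq_le_six_mul)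

/-- `|∫⟪curl v, Dv curl v⟫| ≤ B · ∫|curl v|²` for a `C²` field with `Dv ∈ L²` and `‖Dv x‖ ≤ B` everywhere.
[folklore] -/
theorem stretching_abs_le_gradBound_mul_enstrophy {v : EuclideanSpace ℝ (Fin 3) → EuclideanSpace ℝ (Fin 3)}
    (hv : ContDiff ℝ 2 v) (h1 : ∫⁻ x, ‖iteratedFDeriv ℝ 1 v x‖ₑ ^ 2 < ⊤) {B : ℝ}
    (hB : ∀ x, ‖fderiv ℝ v x‖ ≤ B) :
    |∫ x, ⟪curl v x, fderiv ℝ v x (curl v x)⟫_ℝ| ≤ B * ∫ x, ‖curl v x‖ ^ 2 := by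
  have hcont : Continuous (curl v) := continuous_curl (hv.of_le (by norm_cast))
  have hlt : ∫⁻ x, ‖curl v x‖ₑ ^ 2 < ⊤ :=
    lt_of_le_of_lt (lintegral_mono fun x => enorm_curl_sq_le_six_mul v x)
      (by
        rw [lintegral_const_mul' _ _ (by norm_num)]
        exact ENNReal.mul_lt_top (by norm_num) h1)
  have hint : Integrable (fun x => ‖curl v x‖ ^ 2) := integrable_sq_norm_of_lintegral_lt_top hcont hlt
  have hpt : ∀ x, |⟪curl v x, fderiv ℝ v x (curl v x)⟫_ℝ| ≤ B * ‖curl v x‖ ^ 2 := by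
    intro x
    calc |⟪curl v x, fderiv ℝ v x (curl v x)⟫_ℝ| ≤ ‖curl v x‖ * ‖fderiv ℝ v x (curl v x)‖ :=
          abs_real_inner_le_norm _ _
      _ ≤ ‖curl v x‖ * (B * ‖curl v x‖) := by
          apply mul_le_mul_of_nonneg_left _ (norm_nonneg _)
          exact (ContinuousLinearMap.le_opNorm _ _).trans
            (mul_le_mul_of_nonneg_right (hB x) (norm_nonneg _))
      _ = B * ‖curl v x‖ ^ 2 := by ring
  calc |∫ x, ⟪curl v x, fderiv ℝ v x (curl v x)⟫_ℝ| ≤ ∫ x, |⟪curl v x, fderiv ℝ v x (curl v x)⟫_ℝ| :=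
        abs_integral_le_integral_abs
    _ ≤ ∫ x, B * ‖curl v x‖ ^ 2 :=
        integral_mono_of_nonneg (Eventually.of_forall fun x => abs_nonneg _) (hint.const_mul B)
          (Eventually.of_forall hpt)
    _ = B * ∫ x, ‖curl v x‖ ^ 2 := integral_const_mul _ _

/-- **Efficiency caps palinstrophy by the strain (static).** If `m·M·‖curl v‖₂·‖∇curl v‖₂ < |∫⟪curl v, Dv curl v⟫|`
with `0 < m`, `|v| ≤ M` and `‖Dv‖ ≤ B`, then `m²·M²·∫|∇curl v|²_F ≤ B²·∫|curl v|²`. [folklore] -/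
theorem palinstrophy_le_of_efficient {v : EuclideanSpace ℝ (Fin 3) → EuclideanSpace ℝ (Fin 3)}
    (hv : ContDiff ℝ 2 v) (h1 : ∫⁻ x, ‖iteratedFDeriv ℝ 1 v x‖ₑ ^ 2 < ⊤) {m M B : ℝ} (hm : 0 < m)
    (hM : ∀ x, ‖v x‖ ≤ M) (hB : ∀ x, ‖fderiv ℝ v x‖ ≤ B)
    (heff : m * M * Real.sqrt (∫ x, ‖curl v x‖ ^ 2) * Real.sqrt (∫ x, frobeniusNormSq (fderiv ℝ (curl v) x)) <
      |∫ x, ⟪curl v x, fderiv ℝ v x (curl v x)⟫_ℝ|) :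
    m ^ 2 * M ^ 2 * (∫ x, frobeniusNormSq (fderiv ℝ (curl v) x)) ≤ B ^ 2 * (∫ x, ‖curl v x‖ ^ 2) := by
  set Z : ℝ := ∫ x, ‖curl v x‖ ^ 2 with hZ
  set P : ℝ := ∫ x, frobeniusNormSq (fderiv ℝ (curl v) x) with hP
  have hM0 : 0 ≤ M := (norm_nonneg _).trans (hM 0)
  have hB0 : 0 ≤ B := (norm_nonneg _).trans (hB 0)
  have hZ0 : 0 ≤ Z := integral_nonneg fun x => by positivity
  have hP0 : 0 ≤ P := integral_nonneg fun x => frobeniusNormSq_nonneg _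
  have hJB : |∫ x, ⟪curl v x, fderiv ℝ v x (curl v x)⟫_ℝ| ≤ B * Z :=
    stretching_abs_le_gradBound_mul_enstrophy hv h1 hB
  have hlt : m * M * Real.sqrt Z * Real.sqrt P < B * Z := heff.trans_le hJB
  have hL0 : 0 ≤ m * M * Real.sqrt Z * Real.sqrt P := by positivity
  have hZpos : 0 < Z := by
    rcases hZ0.lt_or_eq with h | h
    · exact h
    · exfalso; rw [← h] at hlt; simp at hlt
  have hsZ : 0 < Real.sqrt Z := Real.sqrt_pos.2 hZpos
  -- divide by `√Z`: `m M √P < B √Z`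
  have hdiv : m * M * Real.sqrt P < B * Real.sqrt Z := by
    have h' : (m * M * Real.sqrt P) * Real.sqrt Z < (B * Real.sqrt Z) * Real.sqrt Z := by
      calc (m * M * Real.sqrt P) * Real.sqrt Z = m * M * Real.sqrt Z * Real.sqrt P := by ring
        _ < B * Z := hlt
        _ = (B * Real.sqrt Z) * Real.sqrt Z := by rw [mul_assoc, Real.mul_self_sqrt hZ0]
    exact lt_of_mul_lt_mul_right h' hsZ.le
  have hL1 : 0 ≤ m * M * Real.sqrt P := by positivity
  have hsq : (m * M * Real.sqrt P) ^ 2 ≤ (B * Real.sqrt Z) ^ 2 := pow_le_pow_left₀ hL1 hdiv.le 2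
  calc m ^ 2 * M ^ 2 * P = (m * M * Real.sqrt P) ^ 2 := by
        rw [mul_pow, mul_pow, Real.sq_sqrt hP0]
    _ ≤ (B * Real.sqrt Z) ^ 2 := hsq
    _ = B ^ 2 * Z := by rw [mul_pow, Real.sq_sqrt hZ0]

/-- **Along the flow: the upper scale-lock modulo rates.** If the per-flow conclusion of
`NearExtremalTransiencePerFlow` fails, then for every `0 < m < κ⋆` and `t₁ < T` the late times with an
amplitude bound `M`, `m·M·√Z·√P < |J|`, and `m²M²·P(t) ≤ B²·Z(t)` for EVERY gradient bound `B` of `u(t)` have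
positive measure. [folklore] -/
theorem palinstrophy_cap_at_nearEfficient_times {ν T : ℝ} (hν : 0 < ν) (hT : 0 < T)
    {u : ℝ → EuclideanSpace ℝ (Fin 3) → EuclideanSpace ℝ (Fin 3)} {p : ℝ → EuclideanSpace ℝ (Fin 3) → ℝ}
    (hsol : IsClassicalNSSolutionOn (Ico 0 T) ν 0 u p) (hLH : IsLerayHopfOn T ν 0 (u 0) u)
    (hdec : HasRapidSpatialDecay (u 0))
    (hnot : ¬ (∃ θ : ℝ, 0 ≤ θ ∧ θ < 1 ∧ ∀ κ : ℝ, (∀ (v : EuclideanSpace ℝ (Fin 3) → EuclideanSpace ℝ (Fin 3)) (M B : ℝ), ContDiff ℝ (⊤ : ℕ∞) v → Literature.Analysis.FluidPDE.VectorCalculus.IsDivFree v → (∀ x, ‖v x‖ ≤ M) → (∀ x, ‖fderiv ℝ v x‖ ≤ B) → (∫⁻ x, ‖iteratedFDeriv ℝ 0 v x‖ₑ ^ 2 < ⊤) → (∫⁻ x, ‖iteratedFDeriv ℝ 1 v x‖ₑ ^ 2 < ⊤) → (∫⁻ x, ‖iteratedFDeriv ℝ 2 v x‖ₑ ^ 2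 < ⊤) → |∫ x, ⟪Literature.Analysis.FluidPDE.curl v x, fderiv ℝ v x (Literature.Analysis.FluidPDE.curl v x)⟫_ℝ| ≤ κ * M * Real.sqrt (∫ x, ‖Literature.Analysis.FluidPDE.curl v x‖ ^ 2) * Real.sqrt (∫ x, Literature.Analysis.FluidPDE.frobeniusNormSq (fderiv ℝ (Literature.Analysis.FluidPDE.curl v) x))) → ∃ t₁ ∈ Set.Ico 0 T, ∃ (k : ℝ → ℝ) (B : ℝ), Measurable k ∧ (∀ τ, 0 ≤ k τ ∧ k τ ≤ 1) ∧ (∀ t ∈ Set.Ico t₁ T, ∀ M : ℝ, (∀ x, ‖u t x‖ ≤ M) → |∫ x, ⟪Literature.Analysis.FluidPDE.curl (u t) x, fderiv ℝ (u t) x (Literature.Analysis.FluidPDE.curl (u t) x)⟫_ℝ| ≤ k t * M * Real.sqrt (∫ x, ‖Literature.Analysis.FluidPDE.curl (u t) x‖ ^ 2) * Real.sqrt (∫ x, Literature.Analysis.FluidPDE.frobeniusNormSq (fderiv ℝ (Literature.Analysis.FluidPDE.curl (u t)) x))) ∧ (∀ t ∈ Set.Ico t₁ T, ∫ τ in t₁..t,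 k τ ^ 2 / (T - τ) ≤ (θ * κ) ^ 2 * Real.log ((T - t₁) / (T - t)) + B))) :
    ∀ m : ℝ, 0 < m → m < sInf {κ : ℝ | (∀ (v : EuclideanSpace ℝ (Fin 3) → EuclideanSpace ℝ (Fin 3)) (M B : ℝ), ContDiff ℝ (⊤ : ℕ∞) v → Literature.Analysis.FluidPDE.VectorCalculus.IsDivFree v → (∀ x, ‖v x‖ ≤ M) → (∀ x, ‖fderiv ℝ v x‖ ≤ B) → (∫⁻ x, ‖iteratedFDeriv ℝ 0 v x‖ₑ ^ 2 < ⊤) → (∫⁻ x, ‖iteratedFDeriv ℝ 1 v x‖ₑ ^ 2 < ⊤) → (∫⁻ x, ‖iteratedFDeriv ℝ 2 v x‖ₑ ^ 2 < ⊤) → |∫ x, ⟪Literature.Analysis.FluidPDE.curl v x, fderiv ℝ v x (Literature.Analysis.FluidPDE.curl v x)⟫_ℝ| ≤ κ * M * Real.sqrt (∫ x, ‖Literature.Analysis.FluidPDE.curl v x‖ ^ 2) * Real.sqrt (∫ x, Literature.Analysis.FluidPDE.frobeniusNormSq (fderiv ℝ (Literature.Analysis.FluidPDE.curl v) x)))}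 → ∀ t₁ ∈ Set.Ico 0 T,
      volume {t : ℝ | t ∈ Set.Ico t₁ T ∧ ∃ M : ℝ, (∀ x, ‖u t x‖ ≤ M) ∧ m * M * Real.sqrt (∫ x, ‖Literature.Analysis.FluidPDE.curl (u t) x‖ ^ 2) * Real.sqrt (∫ x, Literature.Analysis.FluidPDE.frobeniusNormSq (fderiv ℝ (Literature.Analysis.FluidPDE.curl (u t)) x)) < |∫ x, ⟪Literature.Analysis.FluidPDE.curl (u t) x, fderiv ℝ (u t) x (Literature.Analysis.FluidPDE.curl (u t) x)⟫_ℝ| ∧ ∀ B : ℝ, (∀ x, ‖fderiv ℝ (u t) x‖ ≤ B) → m ^ 2 * M ^ 2 * (∫ x, Literature.Analysis.FluidPDE.frobeniusNormSq (fderiv ℝ (Literature.Analysis.FluidPDE.curl (u t)) x)) ≤ B ^ 2 * (∫ x, ‖Literature.Analysis.FluidPDE.curl (u t) x‖ ^ 2)} ≠ 0 := by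
  intro m hm0 hm t₁ ht₁ hnull
  have hloc := isLocalSolution hν hT hsol hLH hdec
  refine nearEfficient_recurrence_of_not_perFlow hν hT hsol hLH hdec hnot m hm t₁ ht₁ (measure_mono_null ?_ hnull)
  rintro t ⟨ht, M, hM, heff⟩
  have htT : t ∈ Set.Ico 0 T := ⟨ht₁.1.trans ht.1, ht.2⟩
  have hv2 : ContDiff ℝ 2 (u t) := (hsol.contDiff_velocity htT).of_le (by norm_cast)
  exact ⟨ht, M, hM, heff, fun B hB => palinstrophy_le_of_efficient hv2 (sobolev_slice hloc htT 1) hm0 hM hB heff⟩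

end Summit.NavierStokesRegularity.NavierStokesRegularity.Theorems.DepletionLadder.PerFlow

end
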